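import Summits.BirchSwinnertonDyer.BirchSwinnertonDyer.Theorems.Rank1ResidualJetLocalTransverse
import Summits.BirchSwinnertonDyer.Rank1Residual.X11b.RingClassFieldConj
import Literature.NumberTheory.GaloisRepresentations.CompletionRestrictionRange
import Literature.NumberTheory.EllipticCurves.SelmerGaloisActionPlaces
import HarnessLib

/-!
# T1 JET (cell `bsd-jet`), road K — the local print-to-type input `h𝒯σ` of the END FORMS is a
# THEOREM: the intrinsic transverse family `H¹_tr(K_λ, E[n]) = ker(H¹(K_λ) → H¹(K[ℓ]_{w'}))` is
# carried by `τ_* : H¹(K_v) → H¹(K_{τ v})` into the transverse family at `τ v` (Gross 1991 §3: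
# `K_n/ℚ` is Galois)

HONEST FRAMING (programme file §HONESTY, verbatim): «no tranche here proves BSD; ARM L moves the
LITERAL column of an r ≤ 1 census into the kernel-proved-modulo-named-print column.» THEOREMS ONLY
(seat `bsd-jet-pv-2`, session g5; `--supports stmt-BirchSwinnertonDyer-14418`, helper); 0 classes
move. WHAT THIS IS. The END FORMS of road K (`JET.jetchevDivisibilityCarrier{Mult,Ne,Add}_of_localFacts`,
p517079 / p517404 / p517696) carry the binder `h𝒯σ`: for the intrinsic transverse Selmer structure
`𝒯` of `exists_localTransverseFamily` (p509971; at a finite place `v`,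
`𝒯_v = ⨅_{ℓ ∣ c, ℓ ∈ v} ⨅_{w' ∣ v} transverseSubgroup (E[n]|_{K_v}) (K[ℓ]_{w'})`) and `τ • v = w`,
`τ_* = conjActPlace W τ n h` maps `𝒯_v` into `𝒯_w`. Printed source: Gross 1991 §3 / Jetchev 2008
§3.2 (1)–(2) presuppose it («`K_n` is Galois over `ℚ`», «anti-equivariant since `K[ℓ]/ℚ` is
dihedral»). PROOF (kernel, no named fact): on cocycles `τ_*[ψ] = [g ↦ τ̃ ψ(Θ⁻¹ g Θ)]`
(`localConjH1_oneCocycleClass`) with `res_v(Θ⁻¹ g Θ) = τ̃⁻¹ res_w(g) τ̃`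
(`LiftsCommute.absGaloisRestrict_conjGalCMH`); by the typer's range theorem
`SemiLocal.mem_range_absGaloisRestrict_adicCompletion_iff` (p-file `CompletionRestrictionRange`,
Cassels–Fröhlich VII §1.1) `d ∈ range(Γ_{K[ℓ]_{w'}} → Γ_{K_v})` iff `res_v d` fixes the embedded
`K[ℓ] ⊂ K̄` pointwise — for EVERY `w' ∣ v`; and `τ̃` maps the embedded `K[ℓ]` onto itself because
`K[ℓ]/ℚ` is Galois (x11b3 `RingClassConj.exists_algEquiv_forall_apply_eq`, Cox Lemma 9.3). Hence
`Θ⁻¹ · range(Γ_{K[ℓ]_{w''}} → Γ_{K_w}) · Θ ⊆ range(Γ_{K[ℓ]_{w'}} → Γ_{K_v})`, and a cocycle that is a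
coboundary `d ↦ d m − m` on the latter becomes the coboundary `g ↦ g (τ̃ m) − τ̃ m` on the former
(`IsLiftOfAut.torsionMap_smul`). So `h𝒯σ` is discharged BY NAME
(`JET.conjActPlace_mem_transverseFamily_forall`, the binder's exact shape).
References: [cite: GrossLMS1991, §3 (K_n/ℚ Galois, τστ⁻¹ = σ⁻¹)] [cite: Jetchev2008, §3.2 (1)–(2)]
[cite: CasselsFrohlichANT1967, Ch. VII §1.1] [cite: Cox2013, §9.A Lemma 9.3]
[cite: SerreLocalFields1979, VII.§5 Prop. 3].
-/

set_option autoImplicit false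

noncomputable section

open scoped Classical

open IsDedekindDomain NumberField Field WeierstrassCurve
  Literature.NumberTheory.GaloisRepresentations
  Literature.NumberTheory.GaloisRepresentations.DiscreteGaloisModule
  Literature.NumberTheory.Automorphic Literature
  Literature.NumberTheory.EllipticCurves Literature.NumberTheory.EllipticCurves.Jetchev2008
  Summit.BirchSwinnertonDyer.Rank1Residual.JET.SelmerVocabulary

namespace Summit.BirchSwinnertonDyer.Rank1Residual.JET

/-! ## §1 The local transport lemma for a Galois extension `E/K` stable under the lift of `σ` -/

section Local

variable {K : Type} [Field K] [NumberField K] (W : WeierstrassCurve ℚ) (σ : K ≃ₐ[ℚ] K) (n : ℤ)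
  {E : Type} [Field E] [NumberField E] [Algebra K E] [IsGalois K E]

/-- **`σ_*` carries `E_{w'}`-transverse classes at `v` to `E_{w''}`-transverse classes at `σ v`.**
For a finite Galois extension `E/K` of number fields, a `K`-embedding `ιE : E → K̄`, places
`w' ∣ v`, `w'' ∣ w` of `E` with `σ • v = w`, and the chosen lift `τ̃ = liftAutPlace σ h` of `σ`
mapping `ιE(E)` into itself (`E/ℚ` normal): if `x ∈ ker(H¹(K_v, E[n]) → H¹(E_{w'}, E[n]))` then
`σ_* x ∈ ker(H¹(K_w, E[n]) → H¹(E_{w''}, E[n]))`. The range of `Γ_{E_{w'}} → Γ_{K_v}` is the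
group of the compositum `K_v(E)` (Cassels–Fröhlich VII §1.1), which `Θ⁻¹(·)Θ` respects because
`res_v(Θ⁻¹ g Θ) = τ̃⁻¹ res_w(g) τ̃` and `τ̃ ιE(E) = ιE(E)`. [cite: CasselsFrohlichANT1967, Ch. VII §1.1]
[cite: SerreLocalFields1979, VII.§5 Prop. 3] -/
theorem conjActPlace_mem_transverseSubgroup_of_liesOver (ιE : E →ₐ[K] AlgebraicClosure K)
    {v w : HeightOneSpectrum (𝓞 K)} (h : σ • v = w)
    (hstab : ∀ e : E, ∃ e' : E, liftAutPlace σ h (ιE e) = ιE e')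
    (w' : HeightOneSpectrum (𝓞 E)) [w'.asIdeal.LiesOver v.asIdeal]
    (w'' : HeightOneSpectrum (𝓞 E)) [w''.asIdeal.LiesOver w.asIdeal]
    {x : galoisCohomology (((W.baseChange K).torsionGaloisModule n).toLocal (Sum.inr v : Place K)) 1}
    (hx : x ∈ (letI := (adicCompletionOfLiesOver K E v w').toAlgebra
      transverseSubgroup (GaloisRep.toLocal v ((W.baseChange K).torsionGaloisModule n))
        (w'.adicCompletion E))) :
    conjActPlace W σ n h x ∈ (letI := (adicCompletionOfLiesOver K E w w'').toAlgebra
      transverseSubgroup (GaloisRep.toLocal w ((W.baseChange K).torsionGaloisModule n))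
        (w''.adicCompletion E)) := by
  letI i₁ := (adicCompletionOfLiesOver K E v w').toAlgebra
  letI i₂ := (adicCompletionOfLiesOver K E w w'').toAlgebra
  -- notation
  let ρ := (W.baseChange K).torsionGaloisModule n
  let M := geomTorsion (W.baseChange K) n
  have hτ := isLiftOfAut_liftAutPlace σ h
  have hΘ := isLiftOfRingEquiv_ringEquivLift (galAdicCompletionEquiv (L := K) σ h)
  have hc := liftsCommute_liftAutPlace σ h
  -- the restriction maps along the local base changes `K_v → E_{w'}`, `K_w → E_{w''}`
  let θ' : absoluteGaloisGroup (w'.adicCompletion E) →ₜ* absoluteGaloisGroup (v.adicCompletion K) :=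
    absGaloisRestrict (v.adicCompletion K) (w'.adicCompletion E)
  let θ'' : absoluteGaloisGroup (w''.adicCompletion E) →ₜ* absoluteGaloisGroup (w.adicCompletion K) :=
    absGaloisRestrict (w.adicCompletion K) (w''.adicCompletion E)
  -- unfold `x = [ψ]`
  obtain ⟨ψ, rfl⟩ := oneCocycleClass_surjective
    (DiscreteGaloisModule.toTopRep (ρ.toLocal (Sum.inr v : Place K))) x
  -- the hypothesis: `ψ` is a coboundary on `range θ'`
  have hx0 : galoisCohomology.res (GaloisRep.toLocal v ρ) (w'.adicCompletion E) 1
      (oneCocycleClass (DiscreteGaloisModule.toTopRep (ρ.toLocal (Sum.inr v : Place K))) ψ) =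
    oneCocycleClass (DiscreteGaloisModule.toTopRep ((GaloisRep.toLocal v ρ).restrictField (w'.adicCompletion E)))
      (contOneCocycles.pullback θ' (TopRep.ofHom ⟨ContinuousLinearMap.id ℤ M, fun _ => rfl⟩) ψ) :=
    map_oneCocycleClass _ _ _ ψ
  rw [show galoisCohomology.res (GaloisRep.toLocal v ρ) (w'.adicCompletion E) 1
      (oneCocycleClass (DiscreteGaloisModule.toTopRep (ρ.toLocal (Sum.inr v : Place K))) ψ)
      = 0 from hx] at hx0
  obtain ⟨m, hm⟩ := (oneCocycleClass_eq_zero_iff _ _).mp hx0.symm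
  have hm' : ∀ d ∈ Set.range θ',
      ψ.1 d = ρ.toTopRep.ρ (absGaloisRestrict K (v.adicCompletion K) d) m - m := by
    rintro _ ⟨g, rfl⟩
    have := hm g
    rw [contOneCocycles.pullback_apply] at this
    exact this
  -- the goal, on cocycles: `σ_*[ψ] = [g ↦ τ̃ ψ(Θ⁻¹ g Θ)]`, restricted along `θ''`
  have hgoal : galoisCohomology.res (GaloisRep.toLocal w ρ) (w''.adicCompletion E) 1
      (conjActPlace W σ n h
        (oneCocycleClass (DiscreteGaloisModule.toTopRep (ρ.toLocal (Sum.inr v : Place K))) ψ)) =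
    oneCocycleClass (DiscreteGaloisModule.toTopRep ((GaloisRep.toLocal w ρ).restrictField (w''.adicCompletion E)))
      (contOneCocycles.pullback θ'' (TopRep.ofHom ⟨ContinuousLinearMap.id ℤ M, fun _ => rfl⟩)
        (contOneCocycles.pullback hΘ.conjGalCMH (localConjHom W hτ hΘ hc n) ψ)) := by
    have h1 : conjActPlace W σ n h
        (oneCocycleClass (DiscreteGaloisModule.toTopRep (ρ.toLocal (Sum.inr v : Place K))) ψ) =
      oneCocycleClass _ (contOneCocycles.pullback hΘ.conjGalCMH (localConjHom W hτ hΘ hc n) ψ) :=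
      localConjH1_oneCocycleClass W hτ hΘ hc n ψ
    rw [h1]
    exact map_oneCocycleClass _ _ _ _
  change galoisCohomology.res (GaloisRep.toLocal w ρ) (w''.adicCompletion E) 1
      (conjActPlace W σ n h
        (oneCocycleClass (DiscreteGaloisModule.toTopRep (ρ.toLocal (Sum.inr v : Place K))) ψ)) = 0
  rw [hgoal]
  refine (oneCocycleClass_eq_zero_iff _ _).mpr ⟨hτ.torsionMap W n m, fun g ↦ ?_⟩
  rw [contOneCocycles.pullback_apply, contOneCocycles.pullback_apply]
  change hτ.torsionMap W n (ψ.1 (hΘ.conjGalCMH (θ'' g))) =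
    absGaloisRestrict K (w.adicCompletion K) (θ'' g) • hτ.torsionMap W n m - hτ.torsionMap W n m
  -- `Θ⁻¹ (θ'' g) Θ ∈ range θ'`: its restriction to `K̄` fixes `ιE(E)` pointwise
  have hmem : hΘ.conjGalCMH (θ'' g) ∈ Set.range θ' := by
    rw [SemiLocal.mem_range_absGaloisRestrict_adicCompletion_iff v ιE w']
    intro e
    rw [hc.absGaloisRestrict_conjGalCMH hτ hΘ]
    have hfix : ∀ e : E, absGaloisRestrict K (w.adicCompletion K) (θ'' g) • ιE e = ιE e :=
      (SemiLocal.mem_range_absGaloisRestrict_adicCompletion_iff w ιE w'' (θ'' g)).mp ⟨g, rfl⟩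
    obtain ⟨e', he'⟩ := hstab e
    change (liftAutPlace σ h).symm ((show AlgebraicClosure K ≃ₐ[K] AlgebraicClosure K from
      absGaloisRestrict K (w.adicCompletion K) (θ'' g)) (liftAutPlace σ h (ιE e))) = ιE e
    rw [he']
    have h1 : (show AlgebraicClosure K ≃ₐ[K] AlgebraicClosure K from
        absGaloisRestrict K (w.adicCompletion K) (θ'' g)) (ιE e') = ιE e' := hfix e'
    rw [h1, ← he', RingEquiv.symm_apply_apply]
  rw [hm' _ hmem, map_sub]
  congr 1
  change hτ.torsionMap W n (absGaloisRestrict K (v.adicCompletion K) (hΘ.conjGalCMH (θ'' g)) • m) = _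
  rw [hc.absGaloisRestrict_conjGalCMH hτ hΘ]
  exact hτ.torsionMap_smul W n _ m

end Local

/-! ## §2 The ring class field: `τ̃ K[ℓ] = K[ℓ]` and the transverse family -/

section RingClass

variable {K : Type} [Field K] [NumberField K]

/-- **Any ring automorphism of `K̄` maps an embedded ring class field `K[ℓ] ⊂ K̄` into itself**
(`ℓ ≠ 0`, `K` imaginary quadratic): `K[ℓ]/ℚ` is Galois (Cox Lemma 9.3, Gross §3 «`K_n` is Galois
over `ℚ`»), so `φ ∘ ιE = ιE ∘ g` for some `g ∈ Aut_ℚ(K[ℓ])`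
(`RingClassConj.exists_algEquiv_forall_apply_eq`). [cite: Cox2013, §9.A Lemma 9.3]
[cite: GrossLMS1991, §3] -/
theorem exists_apply_ringClassField_emb_eq (hK : IsImaginaryQuadratic K) (ι : K →+* ℂ) {ℓ : ℕ}
    (hℓ : ℓ ≠ 0) (ιE : ringClassField K ι ℓ →ₐ[K] AlgebraicClosure K)
    (φ : AlgebraicClosure K ≃+* AlgebraicClosure K) (e : ringClassField K ι ℓ) :
    ∃ e' : ringClassField K ι ℓ, φ (ιE e) = ιE e' := by
  obtain ⟨g, hg⟩ := X11b.RingClassConj.exists_algEquiv_forall_apply_eq hK ι hℓ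
    (ιE : ringClassField K ι ℓ →+* AlgebraicClosure K)
    (φ.toRingHom.comp (ιE : ringClassField K ι ℓ →+* AlgebraicClosure K))
  exact ⟨g e, hg e⟩

/-- **`τ_*` carries `K[ℓ]_{w'}`-transverse classes at `v` to `K[ℓ]_{w''}`-transverse classes at
`τ v`** (every `w' ∣ v`, `w'' ∣ τ v`; `K` imaginary quadratic, `ℓ ≠ 0`). [cite: GrossLMS1991, §3]
[cite: Jetchev2008, §3.2 (1)–(2)] [cite: CasselsFrohlichANT1967, Ch. VII §1.1] -/
theorem conjActPlace_mem_transverseSubgroup_ringClassField (W : WeierstrassCurve ℚ)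
    (hK : IsImaginaryQuadratic K) (ι : K →+* ℂ) [∀ j : ℕ, NumberField (ringClassField K ι j)]
    (τ : K ≃ₐ[ℚ] K) (n : ℤ) {ℓ : ℕ} (hℓ : ℓ ≠ 0) {v w : HeightOneSpectrum (𝓞 K)} (h : τ • v = w)
    (w' : HeightOneSpectrum (𝓞 (ringClassField K ι ℓ))) [w'.asIdeal.LiesOver v.asIdeal]
    (w'' : HeightOneSpectrum (𝓞 (ringClassField K ι ℓ))) [w''.asIdeal.LiesOver w.asIdeal]
    {x : galoisCohomology (((W.baseChange K).torsionGaloisModule n).toLocal (Sum.inr v : Place K)) 1}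
    (hx : x ∈ (letI := (adicCompletionOfLiesOver K (ringClassField K ι ℓ) v w').toAlgebra
      transverseSubgroup (GaloisRep.toLocal v ((W.baseChange K).torsionGaloisModule n))
        (w'.adicCompletion (ringClassField K ι ℓ)))) :
    conjActPlace W τ n h x ∈ (letI := (adicCompletionOfLiesOver K (ringClassField K ι ℓ) w w'').toAlgebra
      transverseSubgroup (GaloisRep.toLocal w ((W.baseChange K).torsionGaloisModule n))
        (w''.adicCompletion (ringClassField K ι ℓ))) := by
  haveI := (finiteDimensional_and_isGalois_ringClassField hK ι hℓ).2
  let ιE : ringClassField K ι ℓ →ₐ[K] AlgebraicClosure K := IsAlgClosed.lift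
  exact conjActPlace_mem_transverseSubgroup_of_liesOver W τ n ιE h
    (fun e ↦ exists_apply_ringClassField_emb_eq hK ι hℓ ιE (liftAutPlace τ h) e) w' w'' hx

/-- **The END FORMS' binder `h𝒯σ`, by name** (shape of `JET.jetchevDivisibilityCarrierMult_of_localFacts`
verbatim): the intrinsic transverse Selmer structure of `exists_localTransverseFamily` is `τ`-stable —
for `v ∣ c`, `τ • v = w` and `x ∈ 𝒯_v`, `τ_* x ∈ 𝒯_w`. (The hypotheses `W` globally minimal, `τ ≠ 1`,
`p ≠ 2`, the Kolyvagin conditions on the prime factors of `c` and `v ∣ c` are part of the binder and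
not used: `τ`-stability holds for every conductor `c` with nonzero prime factors.)
[cite: GrossLMS1991, §3] [cite: Jetchev2008, §3.2 (1)–(2)] -/
theorem conjActPlace_mem_transverseFamily_forall :
    ∀ (W : WeierstrassCurve ℚ) [W.IsElliptic] [W.IsGloballyMinimal]
      (K : Type) [Field K] [NumberField K], IsImaginaryQuadratic K →
      ∀ (ι : K →+* ℂ) [∀ j : ℕ, NumberField (ringClassField K ι j)] (τ : K ≃ₐ[ℚ] K), τ ≠ 1 →
      ∀ (p k : ℕ) [Fact p.Prime], p ≠ 2 →
      ∀ (c : ℕ), Squarefree c → (∀ ℓ ∈ c.primeFactors,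
        Zhang2014.IsKolyvaginPrime (W.conductorNorm ℤ) W K p ℓ ∧ k ≤ Zhang2014.kolyvaginIndex W p ℓ) →
      ∀ (𝒯 : SelmerStructure ((W.baseChange K).torsionGaloisModule ((p ^ k : ℕ) : ℤ))),
      (∀ v : HeightOneSpectrum (𝓞 K), 𝒯 (Sum.inr v) =
        ⨅ ℓ ∈ c.primeFactors.filter (fun ℓ : ℕ ↦ ((ℓ : ℕ) : 𝓞 K) ∈ v.asIdeal),
          ⨅ (w' : HeightOneSpectrum (𝓞 (ringClassField K ι ℓ))) (_ : w'.asIdeal.LiesOver v.asIdeal),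
            letI := (adicCompletionOfLiesOver K (ringClassField K ι ℓ) v w').toAlgebra
            transverseSubgroup (GaloisRep.toLocal v ((W.baseChange K).torsionGaloisModule ((p ^ k : ℕ) : ℤ)))
              (w'.adicCompletion (ringClassField K ι ℓ))) →
      ∀ (v w : HeightOneSpectrum (𝓞 K)) (h : τ • v = w), v ∈ placesDividing K c →
      ∀ x : galoisCohomology (((W.baseChange K).torsionGaloisModule ((p ^ k : ℕ) : ℤ)).toLocal
        (Sum.inr v : Place K)) 1,
      x ∈ 𝒯 (Sum.inr v) → conjActPlace W τ ((p ^ k : ℕ) : ℤ) h x ∈ 𝒯 (Sum.inr w) := by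
  intro W _ _ K _ _ hK ι _ τ _ p k _ _ c _ _ 𝒯 h𝒯 v w h _ x hx
  -- notation (as in `exists_localTransverseFamily`)
  let ρ := (W.baseChange K).torsionGaloisModule ((p ^ k : ℕ) : ℤ)
  let T : ∀ u : HeightOneSpectrum (𝓞 K),
      AddSubgroup (galoisCohomology (ρ.toLocal (Sum.inr u : Place K)) 1) :=
    fun u ↦ ⨅ ℓ ∈ c.primeFactors.filter (fun ℓ : ℕ ↦ ((ℓ : ℕ) : 𝓞 K) ∈ u.asIdeal),
      ⨅ (w' : HeightOneSpectrum (𝓞 (ringClassField K ι ℓ))) (_ : w'.asIdeal.LiesOver u.asIdeal),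
        letI := (adicCompletionOfLiesOver K (ringClassField K ι ℓ) u w').toAlgebra
        transverseSubgroup (GaloisRep.toLocal u ρ) (w'.adicCompletion (ringClassField K ι ℓ))
  have hT : ∀ u, 𝒯 (Sum.inr u) = T u := fun u ↦ h𝒯 u
  -- membership in the family, unfolded
  have hmemT : ∀ (u : HeightOneSpectrum (𝓞 K))
      (y : galoisCohomology (ρ.toLocal (Sum.inr u : Place K)) 1),
      y ∈ T u ↔ ∀ ℓ ∈ c.primeFactors, ((ℓ : ℕ) : 𝓞 K) ∈ u.asIdeal →
        ∀ (w' : HeightOneSpectrum (𝓞 (ringClassField K ι ℓ))) (h' : w'.asIdeal.LiesOver u.asIdeal),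
          y ∈ (letI := (adicCompletionOfLiesOver K (ringClassField K ι ℓ) u w').toAlgebra
            transverseSubgroup (GaloisRep.toLocal u ρ) (w'.adicCompletion (ringClassField K ι ℓ))) := by
    intro u y
    simp only [T, AddSubgroup.mem_iInf, Finset.mem_filter, and_imp]
    exact ⟨fun H ℓ hℓ hu w' h' ↦ AddSubgroup.mem_iInf.mp (H ℓ hℓ hu w') h',
      fun H ℓ hℓ hu w' ↦ AddSubgroup.mem_iInf.mpr (H ℓ hℓ hu w')⟩
  -- `ℓ ∈ w ↔ ℓ ∈ v` for a rational prime `ℓ` (`τ` fixes `ℓ`)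
  have hmem : ∀ ℓ : ℕ, ((ℓ : ℕ) : 𝓞 K) ∈ w.asIdeal ↔ ((ℓ : ℕ) : 𝓞 K) ∈ v.asIdeal := by
    intro ℓ
    rw [← h]
    have hτℓ : τ • ((ℓ : ℕ) : 𝓞 K) = ((ℓ : ℕ) : 𝓞 K) := by
      rw [← MulSemiringAction.toRingHom_apply, map_natCast]
    have := HeightOneSpectrum.smul_mem_smul_asIdeal_iff τ v ((ℓ : ℕ) : 𝓞 K)
    rw [hτℓ] at this
    exact this
  rw [hT v] at hx
  rw [hT w]
  refine (hmemT w _).mpr fun ℓ hℓ hℓw w'' hw'' ↦ ?_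
  have hℓ0 : ℓ ≠ 0 := (Nat.prime_of_mem_primeFactors hℓ).ne_zero
  obtain ⟨w₁⟩ := (SemiLocal.Place.nonempty : Nonempty (SemiLocal.Place K (ringClassField K ι ℓ) v))
  haveI hw' := SemiLocal.Place.liesOver w₁
  let w' : HeightOneSpectrum (𝓞 (ringClassField K ι ℓ)) := w₁
  have hx' := (hmemT v x).mp hx ℓ hℓ ((hmem ℓ).mp hℓw) w' hw'
  haveI := hw''
  exact conjActPlace_mem_transverseSubgroup_ringClassField W hK ι τ ((p ^ k : ℕ) : ℤ) hℓ0 h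
    w' w'' hx'

end RingClass

end Summit.BirchSwinnertonDyer.Rank1Residual.JET

end
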